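import Literature.MathematicalPhysics.QuantumLattice.HubbardTTPrimeGrandCanonicalThermalStatesKMSRows
import Literature.MathematicalPhysics.QuantumLattice.TorusGibbsBogoliubovRow
import HarnessLib

/-!
# Thermal grand-canonical states of the 2D `t–t'` Hubbard model satisfy the Bogoliubov rows for EVERY pair of
# local words

Family `hubbard` (topic `MathematicalPhysics/QuantumLattice`). The Bogoliubov-row twin of
`HubbardTTPrimeGrandCanonicalThermalStatesKMSRows` (stationarity + linearised energy–entropy balance rows of thermal
grand-canonical states for every local generator) and the grand-canonical companion of
`InfVolFermionStateTorusLimitBogoliubovRow` (the same rows for CANONICAL torus limits, restricted to gauge-invariant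
words). For a torus limit `ω` of the grand-canonical Gibbs states of `K_L(t,t',U,μ,h)` (eigen-mixtures
`(sourcedGibbsCount, gcGibbsWeightTT' β …, gcGibbsVectorTT' …)`) at `β ≥ 0`, every `Λ ⊆ Λ'` with `thicken Λ 1 ⊆ Λ'`
and ALL local words `A, C ∈ 𝔄_Λ` (`Ã, C̃` their embeddings in `𝔄_{Λ'}`, `K_{Λ'} = gcLocalHamiltonianTT' Λ' t t' U μ h`):

  `0 ≤ Re ω_{Λ'}( ÃÃᴴ + ÃᴴÃ + 2·(C̃Ã − ÃC̃) + (β/2)·(C̃ᴴ(K_{Λ'}C̃ − C̃K_{Λ'}) − (K_{Λ'}C̃ − C̃K_{Λ'})C̃ᴴ) )`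

(`IsTorusLimitOfMixture.re_expect_bog_nonneg_of_gcGibbs`; minimal window `…_thicken_…`) — the linear form of
Bogoliubov's inequality `|ω([C̃, Ã])|² ≤ ½β ω({Ã, Ãᴴ}) ω([C̃ᴴ, [K, C̃]])` (Dyson–Lieb–Simon (28)) for the
grand-canonical dynamics; read over a template family it is the positive-semidefiniteness of the Bogoliubov block, an
exact KMS constraint linear in the moments of `ω` (row family `bog`), now for the FULL word algebra including charged
words. Ingredients: the generic sector lemma `sum_canonicalWeight_mul_re_expect_bog_mulVec_nonneg` on the TRIVIAL sector
(§1, `sum_gcGibbsWeightTT'_mul_re_expect_bog_fockTranslate_nonneg`: every `B, C`), the torus locality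
`[K_L, ΓC̃] = Γ[K_{Λ'}, C̃]` (`gcTorusHamiltonianTT'_commutator_fermionEmbed`), the translation average (§2) and the
limit (§3). Everything is PROVED; no definition, no named fact, no sorry. WHAT THIS IS NOT: a number; the converse.

## Mathlib / tree search

`lean search 'bog.*gcGibbs'`: nothing (2026-08-27). REUSED: `sum_canonicalWeight_mul_re_expect_bog_mulVec_nonneg`
(`TorusGibbsBogoliubovRow`), `fockTranslate_val_conjTranspose_mul_val_mul`, `fockTranslate_val_mul_val_conjTranspose_mul`
(`TorusGibbsEnergyEntropyBalance`), `gcTorusHamiltonianTT'_commutator_fermionEmbed`, `fockTranslate_commute_gcTorusHamiltonianTT'`,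
`gcLocalHamiltonianTT'` (`HubbardTTPrimeGrandCanonicalThermalStatesKMSRows`), `gcGibbs*TT'`, `canonicalWeight_comp_equiv'`,
`torusAvgExpectAt_of_injOn`, `torusAvgExpect_eq`, `eventually_injOn_proj_of_tendsto`.

## References

* F. J. Dyson, E. H. Lieb, B. Simon, J. Stat. Phys. 18 (1978) 335, §2 eq. (28) (Bogoliubov's inequality).
  [cite: DLS1978, §2 eq. (28)]
* H. Fawzi, O. Fawzi, S. O. Scalet, Nat. Commun. 15 (2024) 7394, Thm. 3.1, §3.2 (KMS constraints of state
  relaxations). [cite: FawziFawziScalet2024, Thm. 3.1]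
-/

noncomputable section

namespace Literature.MathematicalPhysics.QuantumLattice

open Matrix Finset HubbardWave0 Literature.Probability.LatticeModels ThermodynamicLimit LiebThm1
open _root_.Filter
open scoped _root_.Topology ComplexOrder BigOperators

/-! ### §1 Finite volume: the Bogoliubov row in the translated grand-canonical eigen-mixtures, every `B, C` -/

section FiniteVolume

variable (L : ℕ) [NeZero L] {β : ℝ} (hβ : 0 ≤ β) (t t' U μ hz : ℝ)
include hβ

/-- **The Bogoliubov row for the translated grand-canonical Gibbs mixtures, EVERY pair of torus operators `B, C`**
(`β ≥ 0`; no conservation law: the mixture lives on the whole Fock space): for a translation `v`,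
`0 ≤ Σ_i p_{L,i} Re⟨U_vψ_{L,i}, (BBᴴ + BᴴB + 2·(CB − BC) + (β/2)·(Cᴴ(K_L C − C K_L) − (K_L C − C K_L)Cᴴ)) U_vψ_{L,i}⟩`.
[cite: DLS1978, §2 eq. (28)] -/
theorem sum_gcGibbsWeightTT'_mul_re_expect_bog_fockTranslate_nonneg (v : TorusSite 2 L)
    (B C : Matrix (Finset (Orb (FermionTorus 2 L))) (Finset (Orb (FermionTorus 2 L))) ℂ) :
    0 ≤ ∑ i, gcGibbsWeightTT' β t t' U μ hz L i *
      (star ((fockTranslate v).val *ᵥ gcGibbsVectorTT' t t' U μ hz L i) ⬝ᵥ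
        ((B * Bᴴ + Bᴴ * B + ((2 : ℝ) : ℂ) • (C * B - B * C) +
            ((β / 2 : ℝ) : ℂ) • (Cᴴ * (gcTorusHamiltonianTT' L t t' U μ hz * C - C * gcTorusHamiltonianTT' L t t' U μ hz) -
              (gcTorusHamiltonianTT' L t t' U μ hz * C - C * gcTorusHamiltonianTT' L t t' U μ hz) * Cᴴ)) *ᵥ
          ((fockTranslate v).val *ᵥ gcGibbsVectorTT' t t' U μ hz L i))).re := by
  set K := gcTorusHamiltonianTT' L t t' U μ hz with hKdef
  have hK : K.IsHermitian := gcTorusHamiltonianTT'_isHermitian L t t' U μ hz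
  have hvac : ∀ (X : Matrix (Finset (Orb (FermionTorus 2 L))) (Finset (Orb (FermionTorus 2 L))) ℂ)
      (i j : Finset (Orb (FermionTorus 2 L))), ¬ (fun _ => True) i → (fun _ => True) j → X i j = 0 :=
    fun _ _ _ hi _ => (hi trivial).elim
  have key := sum_canonicalWeight_mul_re_expect_bog_mulVec_nonneg (fun _ => True) hK (hvac K)
    (fockTranslate_val_conjTranspose_mul_val_mul L v) (fockTranslate_val_mul_val_conjTranspose_mul L v)
    (fockTranslate_commute_gcTorusHamiltonianTT' L t t' U μ hz v) (hvac _) (hvac _) (hvac B) (hvac Bᴴ)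
    (hvac C) (hvac Cᴴ) hβ
  set e := sourcedGibbsIndex L with he
  refine key.trans_eq ?_
  rw [← Equiv.sum_comp e]
  refine Finset.sum_congr rfl fun i _ => ?_
  rw [gcGibbsWeightTT', show gcGibbsEnergyTT' t t' U μ hz L = sectorEigenvalue (fun _ => True) K hK ∘ e from rfl,
    canonicalWeight_comp_equiv']
  rfl

end FiniteVolume

/-! ### §2 Translation averages of the embedded Bogoliubov rows -/

section TorusAverage

variable (L : ℕ) [NeZero L] {β : ℝ} (hβ : 0 ≤ β) (t t' U μ hz : ℝ)
include hβ

/-- **The Bogoliubov row of ANY two local words, averaged over the torus translations, is nonnegative in the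
grand-canonical Gibbs mixture** (`β ≥ 0`). For `Λ ⊆ Λ'` with `thicken Λ 1 ⊆ Λ'`, `x ↦ x mod L` injective on
`thicken Λ' 1`, `A, C ∈ 𝔄_Λ`, `Ã = Γ_{Λ⊆Λ'}A`, `C̃ = Γ_{Λ⊆Λ'}C`, `K_{Λ'} = gcLocalHamiltonianTT' Λ' t t' U μ h`:
`0 ≤ Re Σ_i p_{L,i} · torusAvgExpectAt L Λ' (ÃÃᴴ + ÃᴴÃ + 2·(C̃Ã − ÃC̃) + (β/2)·(C̃ᴴ[K_{Λ'},C̃] − [K_{Λ'},C̃]C̃ᴴ)) ψ_{L,i}`.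
[cite: DLS1978, §2 eq. (28)] -/
theorem re_sum_gcGibbsWeightTT'_mul_torusAvgExpectAt_bog_nonneg {Λ Λ' : Finset (Site 2)} (hΛ : Λ ⊆ Λ')
    (h8 : thicken Λ 1 ⊆ Λ') (hInj : Set.InjOn (Torus.proj (d := 2) L) ↑(thicken Λ' 1)) (A C : FermionOp Λ) :
    0 ≤ (∑ i, (gcGibbsWeightTT' β t t' U μ hz L i : ℂ) *
      torusAvgExpectAt L Λ'
        (fermionEmbed (PolySite.incl hΛ) A * (fermionEmbed (PolySite.incl hΛ) A)ᴴ +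
          (fermionEmbed (PolySite.incl hΛ) A)ᴴ * fermionEmbed (PolySite.incl hΛ) A +
          ((2 : ℝ) : ℂ) • (fermionEmbed (PolySite.incl hΛ) C * fermionEmbed (PolySite.incl hΛ) A -
            fermionEmbed (PolySite.incl hΛ) A * fermionEmbed (PolySite.incl hΛ) C) +
          ((β / 2 : ℝ) : ℂ) • ((fermionEmbed (PolySite.incl hΛ) C)ᴴ *
              (gcLocalHamiltonianTT' Λ' t t' U μ hz * fermionEmbed (PolySite.incl hΛ) C -
                fermionEmbed (PolySite.incl hΛ) C * gcLocalHamiltonianTT' Λ' t t' U μ hz) -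
            (gcLocalHamiltonianTT' Λ' t t' U μ hz * fermionEmbed (PolySite.incl hΛ) C -
                fermionEmbed (PolySite.incl hΛ) C * gcLocalHamiltonianTT' Λ' t t' U μ hz) *
              (fermionEmbed (PolySite.incl hΛ) C)ᴴ))
        (gcGibbsVectorTT' t t' U μ hz L i)).re := by
  have h₁ : Set.InjOn (Torus.proj (d := 2) L) ↑Λ' := hInj.mono (by exact_mod_cast subset_thicken Λ' 1)
  set K := gcTorusHamiltonianTT' L t t' U μ hz with hKdef
  set B := fermionEmbed (PolySite.toTorusEmb L h₁) (fermionEmbed (PolySite.incl hΛ) A) with hBdef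
  set D := fermionEmbed (PolySite.toTorusEmb L h₁) (fermionEmbed (PolySite.incl hΛ) C) with hDdef
  -- the local commutator pulls back to the torus commutator
  have hKC : fermionEmbed (PolySite.toTorusEmb L h₁)
      (gcLocalHamiltonianTT' Λ' t t' U μ hz * fermionEmbed (PolySite.incl hΛ) C -
        fermionEmbed (PolySite.incl hΛ) C * gcLocalHamiltonianTT' Λ' t t' U μ hz) = K * D - D * K := by
    rw [← gcTorusHamiltonianTT'_commutator_fermionEmbed L t t' U μ hz hΛ h8 hInj C]
  -- pull the row back into the torus
  have hΓ : fermionEmbed (PolySite.toTorusEmb L h₁)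
      (fermionEmbed (PolySite.incl hΛ) A * (fermionEmbed (PolySite.incl hΛ) A)ᴴ +
          (fermionEmbed (PolySite.incl hΛ) A)ᴴ * fermionEmbed (PolySite.incl hΛ) A +
          ((2 : ℝ) : ℂ) • (fermionEmbed (PolySite.incl hΛ) C * fermionEmbed (PolySite.incl hΛ) A -
            fermionEmbed (PolySite.incl hΛ) A * fermionEmbed (PolySite.incl hΛ) C) +
          ((β / 2 : ℝ) : ℂ) • ((fermionEmbed (PolySite.incl hΛ) C)ᴴ *
              (gcLocalHamiltonianTT' Λ' t t' U μ hz * fermionEmbed (PolySite.incl hΛ) C -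
                fermionEmbed (PolySite.incl hΛ) C * gcLocalHamiltonianTT' Λ' t t' U μ hz) -
            (gcLocalHamiltonianTT' Λ' t t' U μ hz * fermionEmbed (PolySite.incl hΛ) C -
                fermionEmbed (PolySite.incl hΛ) C * gcLocalHamiltonianTT' Λ' t t' U μ hz) *
              (fermionEmbed (PolySite.incl hΛ) C)ᴴ)) =
      B * Bᴴ + Bᴴ * B + ((2 : ℝ) : ℂ) • (D * B - B * D) +
        ((β / 2 : ℝ) : ℂ) • (Dᴴ * (K * D - D * K) - (K * D - D * K) * Dᴴ) := by
    rw [fermionEmbed_add, fermionEmbed_add, fermionEmbed_add, fermionEmbed_smul, fermionEmbed_smul, fermionEmbed_sub,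
      fermionEmbed_sub, fermionEmbed_mul, fermionEmbed_mul, fermionEmbed_mul, fermionEmbed_mul, fermionEmbed_mul,
      fermionEmbed_mul, fermionEmbed_conjTranspose, fermionEmbed_conjTranspose, hKC]
  -- each translate is nonnegative
  have hv : ∀ v : TorusSite 2 L, 0 ≤ ∑ i, gcGibbsWeightTT' β t t' U μ hz L i *
      (expect (B * Bᴴ + Bᴴ * B + ((2 : ℝ) : ℂ) • (D * B - B * D) +
          ((β / 2 : ℝ) : ℂ) • (Dᴴ * (K * D - D * K) - (K * D - D * K) * Dᴴ))
        ((fockTranslate v).val *ᵥ gcGibbsVectorTT' t t' U μ hz L i)).re := fun v =>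
    sum_gcGibbsWeightTT'_mul_re_expect_bog_fockTranslate_nonneg L hβ t t' U μ hz v B D
  have hcast : ((Fintype.card (TorusSite 2 L) : ℂ))⁻¹ = (((Fintype.card (TorusSite 2 L) : ℝ)⁻¹ : ℝ) : ℂ) := by
    push_cast; rfl
  simp_rw [torusAvgExpectAt_of_injOn L h₁, hΓ]
  rw [Complex.re_sum]
  simp_rw [hcast, ← mul_assoc, ← Complex.ofReal_mul, Complex.re_ofReal_mul, Complex.re_sum, Finset.mul_sum]
  rw [Finset.sum_comm]
  refine Finset.sum_nonneg fun v _ => ?_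
  have hfac : ∑ i, gcGibbsWeightTT' β t t' U μ hz L i * (Fintype.card (TorusSite 2 L) : ℝ)⁻¹ *
      (expect (B * Bᴴ + Bᴴ * B + ((2 : ℝ) : ℂ) • (D * B - B * D) +
          ((β / 2 : ℝ) : ℂ) • (Dᴴ * (K * D - D * K) - (K * D - D * K) * Dᴴ))
        ((fockTranslate v).val *ᵥ gcGibbsVectorTT' t t' U μ hz L i)).re =
      (Fintype.card (TorusSite 2 L) : ℝ)⁻¹ * ∑ i, gcGibbsWeightTT' β t t' U μ hz L i *
      (expect (B * Bᴴ + Bᴴ * B + ((2 : ℝ) : ℂ) • (D * B - B * D) +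
          ((β / 2 : ℝ) : ℂ) • (Dᴴ * (K * D - D * K) - (K * D - D * K) * Dᴴ))
        ((fockTranslate v).val *ᵥ gcGibbsVectorTT' t t' U μ hz L i)).re := by
    rw [Finset.mul_sum]
    exact Finset.sum_congr rfl fun i _ => by ring
  rw [hfac]
  exact mul_nonneg (inv_nonneg.2 (Nat.cast_nonneg _)) (hv v)

end TorusAverage

/-! ### §3 The Bogoliubov rows of thermal grand-canonical states, every pair of local words -/

namespace InfVolFermionState

variable {β : ℝ} (hβ : 0 ≤ β) (t t' U μ hz : ℝ) {ω : InfVolFermionState 2} {Ls : ℕ → ℕ}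
include hβ

/-- **Bogoliubov rows of thermal grand-canonical states, for EVERY pair of local words.** Let `ω` be a torus
limit of the grand-canonical Gibbs states of `K_{Ls j}(t,t',U,μ,h)` at inverse temperature `β ≥ 0` along
`Ls → ∞`. Then for `Λ ⊆ Λ'` with `thicken Λ 1 ⊆ Λ'`, all `A, C ∈ 𝔄_Λ` (charged or not; `Ã = Γ_{Λ⊆Λ'}A`,
`C̃ = Γ_{Λ⊆Λ'}C`) and `K_{Λ'} = H^{tt'}_{Λ'} − μN_{Λ'} − hM_{Λ'}`:

  `0 ≤ Re ω_{Λ'}( ÃÃᴴ + ÃᴴÃ + 2·(C̃Ã − ÃC̃) + (β/2)·(C̃ᴴ(K_{Λ'}C̃ − C̃K_{Λ'}) − (K_{Λ'}C̃ − C̃K_{Λ'})C̃ᴴ) )`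

— the linear form of Bogoliubov's inequality `|ω([C̃, Ã])|² ≤ ½β ω({Ã, Ãᴴ}) ω([C̃ᴴ, [K, C̃]])` of a `β`-KMS state
for the grand-canonical dynamics (row family `bog` of the `T > 0` certificates, here for the full word algebra).
[cite: DLS1978, §2 eq. (28)] [cite: FawziFawziScalet2024, Thm. 3.1] -/
theorem IsTorusLimitOfMixture.re_expect_bog_nonneg_of_gcGibbs
    (h : ω.IsTorusLimitOfMixture sourcedGibbsCount (gcGibbsWeightTT' β t t' U μ hz)
      (gcGibbsVectorTT' t t' U μ hz) Ls)
    (hLs : Tendsto Ls atTop atTop) {Λ Λ' : Finset (Site 2)} (hΛ : Λ ⊆ Λ') (h8 : thicken Λ 1 ⊆ Λ')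
    (A C : FermionOp Λ) :
    0 ≤ (ω.expect Λ'
      (fermionEmbed (PolySite.incl hΛ) A * (fermionEmbed (PolySite.incl hΛ) A)ᴴ +
          (fermionEmbed (PolySite.incl hΛ) A)ᴴ * fermionEmbed (PolySite.incl hΛ) A +
          ((2 : ℝ) : ℂ) • (fermionEmbed (PolySite.incl hΛ) C * fermionEmbed (PolySite.incl hΛ) A -
            fermionEmbed (PolySite.incl hΛ) A * fermionEmbed (PolySite.incl hΛ) C) +
          ((β / 2 : ℝ) : ℂ) • ((fermionEmbed (PolySite.incl hΛ) C)ᴴ *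
              (gcLocalHamiltonianTT' Λ' t t' U μ hz * fermionEmbed (PolySite.incl hΛ) C -
                fermionEmbed (PolySite.incl hΛ) C * gcLocalHamiltonianTT' Λ' t t' U μ hz) -
            (gcLocalHamiltonianTT' Λ' t t' U μ hz * fermionEmbed (PolySite.incl hΛ) C -
                fermionEmbed (PolySite.incl hΛ) C * gcLocalHamiltonianTT' Λ' t t' U μ hz) *
              (fermionEmbed (PolySite.incl hΛ) C)ᴴ))).re := by
  refine ge_of_tendsto ((Complex.continuous_re.tendsto _).comp (h Λ' _)) ?_
  filter_upwards [eventually_injOn_proj_of_tendsto (thicken Λ' 1) hLs, hLs.eventually_ge_atTop 1]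
    with j hInj hj
  haveI : NeZero (Ls j) := ⟨by omega⟩
  rw [Function.comp_apply]
  simp_rw [torusAvgExpect_eq]
  exact re_sum_gcGibbsWeightTT'_mul_torusAvgExpectAt_bog_nonneg (Ls j) hβ t t' U μ hz hΛ h8 hInj A C

/-- The Bogoliubov rows in the minimal window `Λ' = thicken Λ 1`. [cite: DLS1978, §2 eq. (28)] -/
theorem IsTorusLimitOfMixture.re_expect_bog_thicken_nonneg_of_gcGibbs
    (h : ω.IsTorusLimitOfMixture sourcedGibbsCount (gcGibbsWeightTT' β t t' U μ hz)
      (gcGibbsVectorTT' t t' U μ hz) Ls)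
    (hLs : Tendsto Ls atTop atTop) {Λ : Finset (Site 2)} (A C : FermionOp Λ) :
    0 ≤ (ω.expect (thicken Λ 1)
      (fermionEmbed (PolySite.incl (subset_thicken Λ 1)) A * (fermionEmbed (PolySite.incl (subset_thicken Λ 1)) A)ᴴ +
          (fermionEmbed (PolySite.incl (subset_thicken Λ 1)) A)ᴴ * fermionEmbed (PolySite.incl (subset_thicken Λ 1)) A +
          ((2 : ℝ) : ℂ) • (fermionEmbed (PolySite.incl (subset_thicken Λ 1)) C *
              fermionEmbed (PolySite.incl (subset_thicken Λ 1)) A -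
            fermionEmbed (PolySite.incl (subset_thicken Λ 1)) A *
              fermionEmbed (PolySite.incl (subset_thicken Λ 1)) C) +
          ((β / 2 : ℝ) : ℂ) • ((fermionEmbed (PolySite.incl (subset_thicken Λ 1)) C)ᴴ *
              (gcLocalHamiltonianTT' (thicken Λ 1) t t' U μ hz * fermionEmbed (PolySite.incl (subset_thicken Λ 1)) C -
                fermionEmbed (PolySite.incl (subset_thicken Λ 1)) C * gcLocalHamiltonianTT' (thicken Λ 1) t t' U μ hz) -
            (gcLocalHamiltonianTT' (thicken Λ 1) t t' U μ hz * fermionEmbed (PolySite.incl (subset_thicken Λ 1)) C -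
                fermionEmbed (PolySite.incl (subset_thicken Λ 1)) C * gcLocalHamiltonianTT' (thicken Λ 1) t t' U μ hz) *
              (fermionEmbed (PolySite.incl (subset_thicken Λ 1)) C)ᴴ))).re :=
  h.re_expect_bog_nonneg_of_gcGibbs hβ t t' U μ hz hLs (subset_thicken Λ 1) subset_rfl A C

end InfVolFermionState

end Literature.MathematicalPhysics.QuantumLattice

end
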